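import Summits.Ventures.CertifiedManyBodySolver.Downfold.EmeryVanHoveSubBox
import Summits.Ventures.CertifiedManyBodySolver.Downfold.EmeryVanHoveTableE
import Summits.Ventures.CertifiedManyBodySolver.Downfold.EmeryBoxesKSlicesM
import HarnessLib

/-!
# Pr₄Ni₃O₈ (#189 / M330) INNER Ni plane: the CERTIFIED van Hove (Lifshitz) hole doping of the σ three-band model on the typed 3BE one-body box
# — `x_VH ∈ [0.1440, 0.2150]`

Venture CertifiedManyBodySolver, cell `pub/hubbard-downfold` (stage S1, HUMAN RULINGS D-0096/D-0098: the three-band → one-band reduction error is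
carried explicitly), seat hubbard-downfold-mod-4 (technique B = band level); namespace `Summit.Ventures.CertifiedManyBodySolver.Downfold.Emery`.
Everything PROVED; numerics decided by the kernel (ONE `vhBoxCheck` + two entries of the certified table of `Ψ`, `EmeryVanHoveTableE`).

DEVICE (`EmeryVanHoveFactorisation` / `EmeryVanHoveSubBox`): the σ-model van Hove hole doping `x_VH = 1 − 2·abFilling(ε_VH)` (the hole count per Cu,
relative to the half-filled antibonding band, at which the Fermi level reaches the saddle point `ε_AB(X)`) FACTORISES as `x_VH = 1 − 2Ψ(q)`,
`q = u(1 + u)`, **`u = 2(t_pp + t_pp′)/(Δ_pd + ε_VH)`**, with `Ψ` universal and antitone; `u` is monotone in each band parameter, so the window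
below is CORNER-EXACT up to the table resolution (±0.005 per side, `K = 384` grid).

THE STATEMENT (`pr438inBox_xVH`, typed words `emeryBoxPr438inYK26Src`). For every parameter vector of the box
Δ_pd [3.4, 4.27] × t_pd [1.15, 1.36] × t_pp [0.57, 0.68] × t_pp′ [0.06, 0.09] (one-body rows of Pr₄Ni₃O₈ (#189 / M330) INNER Ni plane):
**ε_VH ∈ [0.9483, 1.453]** (eV above ε_d), **Δ_pd + ε_VH ∈ [4.49, 5.548]**, **q ∈ [0.2786, 0.4606]**
(i.e. the σ Fermi-surface `−t′/t` AT THE SADDLE ENERGY `ρ = q/(1 + 2q) ∈ [0.1789, 0.2397]`), `x_VH = 1 − 2Ψ(q)`, and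
**`x_VH ∈ [0.1440, 0.2150]`** (table entries `Ψ(11/40) ≤ 63108/147456`, `Ψ(93/200) ≥ 57880/147456`).
Float truth at the two extreme corners (not a theorem): x_VH ∈ [0.1506, 0.2085].

READING (the box file's business; comparators are [float]): see the box file addendum / router/EMERY-FS-WINDOWS.md §x_VH.
WHAT THIS IS NOT: not a statement that the material's parameters ARE in the box (SCREENING-GRADE provenance); `U = 0` band kinematics of the σ
d–p_x–p_y(+t_pp, t_pp′) model; the identification of a material's LIFSHITZ transition with this one-body crossing is the consumer's modelling claim
(correlations and the axial / longer-range one-body channels both move it); no phase sentence. Sources: [HybertsenSchluterChristensen1989, Eq. (1)];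
[AndersenEtAl1995, §6]; [PavariniEtAl2001, Eq. (1)].
-/

noncomputable section

namespace Summit.Ventures.CertifiedManyBodySolver.Downfold.Emery

open Real Set
open Summit.Ventures.CertifiedManyBodySolver.Downfold

/-- **Pr₄Ni₃O₈ (#189 / M330) INNER Ni plane — raw-coordinate van Hove certificate**: on Δ_pd [3.4, 4.27] × t_pd [1.15, 1.36] × t_pp [0.57, 0.68] × t_pp′ [0.06, 0.09]: `ε_VH ∈ [0.9483, 1.453]`,
`q ∈ [0.2786, 0.4606]`, `x_VH = 1 − 2Ψ(q)` and `x_VH ∈ [0.1440, 0.2150]`. [folklore] -/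
theorem pr438inBox_xVH {Δ tpd tpp c : ℝ} (hΔ : Δ ∈ Set.Icc (17 / 5 : ℝ) (427 / 100 : ℝ))
    (ha : tpd ∈ Set.Icc (23 / 20 : ℝ) (34 / 25 : ℝ)) (hb : tpp ∈ Set.Icc (57 / 100 : ℝ) (17 / 25 : ℝ))
    (hc : c ∈ Set.Icc (3 / 50 : ℝ) (9 / 100 : ℝ)) :
    vhEnergy Δ tpd c ∈ Set.Icc (9483 / 10000 : ℝ) (908 / 625 : ℝ) ∧ vhRatio Δ tpd tpp c ∈ Set.Icc (1393 / 5000 : ℝ) (2303 / 5000 : ℝ) ∧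
      xVH Δ tpd tpp c = 1 - 2 * vhFrac (vhRatio Δ tpd tpp c) ∧ xVH Δ tpd tpp c ∈ Set.Icc (295 / 2048 : ℝ) (1981 / 9216 : ℝ) := by
  have h := xVH_window_of_vhBoxCheck
    (Δ₁ := ((17 : ℚ) / 5)) (Δ₂ := ((427 : ℚ) / 100)) (a₁ := ((23 : ℚ) / 20)) (a₂ := ((34 : ℚ) / 25)) (b₁ := ((57 : ℚ) / 100)) (b₂ := ((17 : ℚ) / 25))
    (c₁ := ((3 : ℚ) / 50)) (c₂ := ((9 : ℚ) / 100)) (v₁ := ((9483 : ℚ) / 10000)) (v₂ := ((908 : ℚ) / 625)) (e := ((2181 : ℚ) / 2000)) (E := ((6391 : ℚ) / 5000))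
    (q₁ := ((1393 : ℚ) / 5000)) (q₂ := ((2303 : ℚ) / 5000)) (by decide +kernel)
    (Δ := Δ) (tpd := tpd) (tpp := tpp) (c := c) (by simpa using hΔ) (by simpa using ha) (by simpa using hb) (by simpa using hc)
  obtain ⟨hv, -, hq, -, heq, hwin⟩ := h
  push_cast at hv hq hwin
  have hx := xVH_window_of_table hwin (qa := (11 / 40 : ℝ)) (qb := (93 / 200 : ℝ)) (by norm_num) (by norm_num) vhFrac_11_40.2 vhFrac_93_200.1
  exact ⟨⟨by linarith [hv.1], by linarith [hv.2]⟩, ⟨by linarith [hq.1], by linarith [hq.2]⟩, heq,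
    ⟨by linarith [hx.1], by linarith [hx.2]⟩⟩

/-- The four ONE-BODY rows of `emeryBoxPr438inYK26Src` (`EmeryBoxesKSlicesM`) this file reads. [folklore] -/
theorem emeryBoxPr438inYK26Src_oneBodyRows {p : EmeryCoord → ℝ} (hp : emeryBoxPr438inYK26Src.Mem p) :
    p .DeltaPd ∈ Set.Icc (17 / 5 : ℝ) (427 / 100 : ℝ) ∧ p .tpd ∈ Set.Icc (23 / 20 : ℝ) (34 / 25 : ℝ) ∧
      p .tpp ∈ Set.Icc (57 / 100 : ℝ) (17 / 25 : ℝ) ∧ p .tppP ∈ Set.Icc (3 / 50 : ℝ) (9 / 100 : ℝ) := by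
  have hΔ := (Entry.mem_ofEnds_iff _ _ _ _ _).1 (hp .DeltaPd pr438inYK26Emery_DeltaKS rfl)
  have ha := (Entry.mem_ofEnds_iff _ _ _ _ _).1 (hp .tpd pr438inYK26Emery_tpd rfl)
  have hb := (Entry.mem_ofEnds_iff _ _ _ _ _).1 (hp .tpp pr438inYK26Emery_tpp rfl)
  have hc := (Entry.mem_ofEnds_iff _ _ _ _ _).1 (hp .tppP pr438inYK26Emery_tppP rfl)
  push_cast at hΔ ha hb hc
  exact ⟨⟨hΔ.1, hΔ.2⟩, ⟨ha.1, ha.2⟩, ⟨hb.1, hb.2⟩, ⟨hc.1, hc.2⟩⟩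

/-- **THE WORD ON THE TYPED BOX `emeryBoxPr438inYK26Src`**: at every parameter vector the σ three-band van Hove (Lifshitz) hole doping lies in
`[0.1440, 0.2150]` (holes per Cu relative to the half-filled antibonding band). [cite: HybertsenSchluterChristensen1989, Eq. (1) (three-band d–p model)] -/
theorem emeryBoxPr438inYK26Src_xVH_window :
    HoldsOn (fun p : EmeryCoord → ℝ =>
      xVH (p .DeltaPd) (p .tpd) (p .tpp) (p .tppP) ∈ Set.Icc (295 / 2048 : ℝ) (1981 / 9216 : ℝ)) emeryBoxPr438inYK26Src := by
  intro p hp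
  obtain ⟨hΔ, ha, hb, hc⟩ := emeryBoxPr438inYK26Src_oneBodyRows hp
  exact (pr438inBox_xVH hΔ ha hb hc).2.2.2

/-- On `emeryBoxPr438inYK26Src`: the saddle energy `ε_VH ∈ [0.9483, 1.453]` and the ratio `q ∈ [0.2786, 0.4606]` (`−t′/t` at the saddle energy
`∈ [0.1789, 0.2397]`). [folklore] -/
theorem emeryBoxPr438inYK26Src_vhEnergy_vhRatio_window :
    HoldsOn (fun p : EmeryCoord → ℝ =>
      vhEnergy (p .DeltaPd) (p .tpd) (p .tppP) ∈ Set.Icc (9483 / 10000 : ℝ) (908 / 625 : ℝ) ∧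
      vhRatio (p .DeltaPd) (p .tpd) (p .tpp) (p .tppP) ∈ Set.Icc (1393 / 5000 : ℝ) (2303 / 5000 : ℝ)) emeryBoxPr438inYK26Src := by
  intro p hp
  obtain ⟨hΔ, ha, hb, hc⟩ := emeryBoxPr438inYK26Src_oneBodyRows hp
  exact (pr438inBox_xVH hΔ ha hb hc)|> fun h => ⟨h.1, h.2.1⟩

end Summit.Ventures.CertifiedManyBodySolver.Downfold.Emery
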